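import Literature.NumberTheory.LFunctions.Zhang2022.Section8MainTerms
import Literature.NumberTheory.LFunctions.Zhang2022.Section8Certificate

/-!
# Zhang (2022) §8: from (8.11) to (8.19)–(8.23) — the two changes of variables, kernel-checked

Trunk T-ANT (NumberTheory/LFunctions). Companion of `Section8Defs.lean`, `Section8ClosedForm.lean`,
`Section8Certificate.lean`, `Section8MainTerms.lean` (Y. Zhang, *Discrete mean estimates and the
Landau–Siegel zero*, arXiv:2211.02515v1 (2022) [Zhang2022LandauSiegel], §8, pp. 17–18 of the source;
**an unrefereed manuscript, a claimed result under adjudication** — this file reproduces the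
elementary-calculus links of its §8 and asserts nothing about its Theorems 1–2).

What the companions already carry: `Section8MainTerms` proves that the displayed residue integrals of
Lemmas 8.2/8.4, at the MAIN VALUES of the shifts (`β_j⁰ = jiα`, `β₆ = 3iα/2`, `β₇ = 5iα/2`,
`β₄ = β₁, β₅ = β₂`, `α log P = π`), are exactly the printed profiles `𝔣𝔣_{jμ}, 𝔤𝔥_{jμ}` of
(8.13)–(8.18) (`frakf_main_*`, `frakg_main_*`); `Section8Defs` transcribes (8.19)–(8.23) and
`Section8Certificate` proves `not_ineq824 : ¬(𝔠₁ < 6.9955)`. The one computational passage of §8 left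
outside the kernel was the text between (8.11) and (8.19) [p. 17 L148 – p. 18 L47 of the source]:

* (8.11) → (8.12): "This yields, by the change of variable `x → P₁/x` or `x → P₂/x`, … since
  `P₁/P₂ = P^{0.004}T^{10}`";
* (8.12) → the four displays after (8.18): "Substituting `x = Pᶻ` we obtain …" (with
  `𝔣_{jμ}(Pᶻ) = 𝔣𝔣_{jμ}(z) + O(ℒ⁻⁸)`, `log P₁ = 0.504 log P`, `log P₂ = (0.5 + o(1)) log P`);
* "Inserting these into (8.13) we obtain
  `(2α)⁻¹S₁ + 2α⁻¹S₂ + (3/2)α⁻¹S₃ = 𝔞(b₁₁ + ι₂b₂₁ + ῑ₂b₁₂ + |ι₂|²b₂₂) + o(1)`" with the `b_{kl}`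
  of (8.19)–(8.22) (the weights `1/2, 2, 3/2` and `α⁻¹` are those of Proposition 7.1);
* (8.7) + (8.23): `Ξ₁₁ = 2Re Θ₁(a₁₁,a₂₁) + o(𝔓)`, so `𝔠₁ = c₁₁ + ι₂c₂₁ + ῑ₂c₁₂ + |ι₂|²c₂₂` with
  `c₁₁ = b₁₁ + b̄₁₁`, `c₂₂ = b₂₂ + b̄₂₂`, `c₁₂ = b₁₂ + b̄₂₁`, `c₂₁ = c̄₁₂`.

This file PROVES these links EXACTLY, at main order, i.e. with the following (and only the
following) idealisations, each of which is one of the manuscript's own `o(·)` simplifications: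
(M1) the shifts at their main values (as in `Section8MainTerms`; the manuscript's `+O(ℒ⁻⁸)`);
(M2) `P₁ = P^{θ₁}`, `P₂ = P^{θ₂}` with REAL exponents `θ₁, θ₂` — the manuscript's (2.21) is
`P₁ = P^{0.504}`, `P₂ = P^{0.5}T^{-10}` with `T = exp{ℒ^{1.1}}` (§6), i.e. `θ₁ = 0.504` and
`θ₂ = 0.5 − 10ℒ^{-7.9}`; everything up to `S812_eq_zform` holds for ARBITRARY `θ₁, θ₂` (so also for
the true `θ₂`), and only the final identification with the printed `b_{kl}` is made at the main value
`θ₂ = 0.5` (`θ₁ − θ₂ = 0.004`), exactly as the four displays after (8.18) do ("+o(α)");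
(M3) the overall factor `𝔞` and the error terms `o(α)` of (8.11)/(8.12) are omitted (the statements
are about the displayed integrals).

| decl | display | content |
|---|---|---|
| `integral_comp_div_inv` | "change of variable `x → Q/x`" | `∫_A^B h(Q/x)dx/x = ∫_{Q/B}^{Q/A} h(u)du/u` (`A,B,Q > 0`, any `h`) |
| `integral_comp_exp_mul` | "substituting `x = Pᶻ`" | `Λ∫_a^b g(e^{Λz})dz = ∫_{e^{Λa}}^{e^{Λb}} g(x)dx/x` (`Λ ≥ 0`, any `g`) |
| `S811`, `S812` | (8.11), (8.12) | the right-hand sides without `𝔞`, `o(α)`, for one `j`, as functionals of the four `x`-profiles `𝔣_{j6}, 𝔣_{j7}, 𝔤_{j6}, 𝔤_{j7}` |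
| `S811_eq_S812` | (8.11) ⇒ (8.12) | PROVED for any profiles continuous on `(0,∞)` and any `θ₁, θ₂` |
| `display818_diag`, `display818_cross₁/₂` | the four displays after (8.18) | PROVED for any `θ`'s, given `𝔣(Pᶻ) = 𝔣𝔣(z)` |
| `S812_eq_zform` | (8.12) in `z` | PROVED (any `θ₁, θ₂ ≠ 0`) |
| `fX`, `gX` | Lemma 8.2/8.4 | `𝔣_{jμ}(x)`, `𝔤_{jμ}(x)` at main values, real `x > 0` |
| `weighted_sum_S811_main` | display before (8.19) | `(2α)⁻¹S₁ + 2α⁻¹S₂ + (3/2)α⁻¹S₃ = b₁₁ + ι₂b₂₁ + ῑ₂b₁₂ + |ι₂|²b₂₂` PROVED at `θ = (0.504, 0.5)`, `αΛ = π` |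
| `frakc1_eq_coeff_add_conj` | (8.7), (8.23) | `𝔠₁ = B + B̄`, `B = b₁₁ + ι₂b₂₁ + ῑ₂b₁₂ + |ι₂|²b₂₂` |
| `weighted_sum_S811_add_conj` | end to end | `W + W̄ = 𝔠₁ > 7.0501`, `¬(Re(W + W̄) < 6.9955)` for the (8.11)-level sum `W` |

Consequence for the record (no new claim): the kernel now carries the whole computational chain of
§8 — displayed integrands of Lemmas 8.2/8.4 on `|s| = 5α` (`Section8MainTerms`) → (8.13)–(8.18) →
(8.11) = (8.12) → (8.19)–(8.22) → (8.23) → `𝔠₁ = 7.0501…` → `¬`(8.24) (`Section8Certificate`), and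
in particular confirms that the printed (8.19)–(8.22) ARE the correct outcome of (8.11) (the label
pattern `ι₂ ↔ b₂₁ = ∫𝔣𝔣_{j7}(z)𝔤𝔥_{j6}(z+0.004)`, `ῑ₂ ↔ b₁₂` included), so that the failure of
(8.24) is not an artefact of this passage. What remains outside the kernel in §§7–8 is the analytic
number theory proper: Proposition 7.1; the contour shifts and error terms of Lemmas 8.2–8.4 under
hypothesis (A); Lemma 8.3/Appendix A; `λ₀ⱼ(n) = φ(n)²/n² + O(α₁)`; and the partial summation
("[T, 1.2.12]") that produces (8.11) itself.
-/

noncomputable section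

open Complex Real Set MeasureTheory ComplexConjugate

namespace Literature.NumberTheory.LFunctions.Zhang2022

/-! ### The two substitutions (generic real-variable calculus) -/

/-- The reflection `x ↦ Q/x` on a positive interval ("the change of variable `x → P₁/x` or
`x → P₂/x`" of (8.12)): `∫_A^B h(Q/x) dx/x = ∫_{Q/B}^{Q/A} h(u) du/u` for `A, B, Q > 0` and ANY
`h : ℝ → ℂ` (Mathlib's antitone substitution rule needs no hypothesis on the integrand). [folklore] -/
theorem integral_comp_div_inv {A B Q : ℝ} (hA : 0 < A) (hB : 0 < B) (hQ : 0 < Q) (h : ℝ → ℂ) :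
    ∫ x in A..B, h (Q / x) / x = ∫ u in Q/B..Q/A, h u / u := by
  have hpos : ∀ x ∈ uIcc A B, 0 < x := fun x hx => (lt_min hA hB).trans_le hx.1
  have hpos' : ∀ x ∈ Ioo (min A B) (max A B), 0 < x := fun x hx => (lt_min hA hB).trans hx.1
  have key := intervalIntegral.integral_deriv_smul_comp_of_deriv_nonpos
    (f := fun x : ℝ => Q / x) (f' := fun x : ℝ => -Q / x ^ 2) (g := fun u : ℝ => h u / u)
    (a := A) (b := B) ?_ ?_ ?_
  · rw [intervalIntegral.integral_symm (Q/A) (Q/B)]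
    change (∫ x in A..B, (fun x : ℝ => -Q / x ^ 2) x
        • ((fun u : ℝ => h u / ↑u) ∘ fun x : ℝ => Q / x) x) = ∫ u in Q/A..Q/B, h u / u at key
    rw [← key, ← intervalIntegral.integral_neg]
    apply intervalIntegral.integral_congr
    intro x hx
    have hx0 : (x : ℂ) ≠ 0 := by exact_mod_cast (hpos x hx).ne'
    have hQ0 : (Q : ℂ) ≠ 0 := by exact_mod_cast hQ.ne'
    simp only [Function.comp_apply, Complex.real_smul]
    push_cast
    field_simp
  · exact continuousOn_const.div continuousOn_id fun x hx => (hpos x hx).ne'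
  · intro x hx
    have hx0 : x ≠ 0 := (hpos' x hx).ne'
    have h1 : HasDerivAt (fun y : ℝ => Q * y⁻¹) (Q * -(x ^ 2)⁻¹) x := (hasDerivAt_inv hx0).const_mul Q
    have h2 : (fun y : ℝ => Q / y) = fun y => Q * y⁻¹ := by funext y; rw [div_eq_mul_inv]
    rw [h2]
    exact h1.congr_deriv (by ring)
  · intro x _
    exact div_nonpos_of_nonpos_of_nonneg (neg_nonpos.mpr hQ.le) (sq_nonneg x)

/-- The exponential substitution `x = e^{Λz}`, `dx/x = Λ dz` ("Substituting `x = Pᶻ`", with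
`Λ = log P`): `Λ ∫_a^b g(e^{Λz}) dz = ∫_{e^{Λa}}^{e^{Λb}} g(x) dx/x` for `Λ ≥ 0` and ANY `g : ℝ → ℂ`.
[folklore] -/
theorem integral_comp_exp_mul {a b Λ : ℝ} (hΛ : 0 ≤ Λ) (g : ℝ → ℂ) :
    (Λ : ℂ) * ∫ z in a..b, g (rexp (Λ * z)) = ∫ x in rexp (Λ * a)..rexp (Λ * b), g x / x := by
  have key := intervalIntegral.integral_deriv_smul_comp_of_deriv_nonneg
    (f := fun z : ℝ => rexp (Λ * z)) (f' := fun z : ℝ => Λ * rexp (Λ * z))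
    (g := fun x : ℝ => g x / x) (a := a) (b := b) ?_ ?_ ?_
  · change (∫ z in a..b, (fun z : ℝ => Λ * rexp (Λ * z)) z
        • ((fun x : ℝ => g x / ↑x) ∘ fun z : ℝ => rexp (Λ * z)) z)
        = ∫ x in rexp (Λ * a)..rexp (Λ * b), g x / x at key
    rw [← key, ← intervalIntegral.integral_const_mul]
    apply intervalIntegral.integral_congr
    intro z _
    have h0 : (rexp (Λ * z) : ℂ) ≠ 0 := by exact_mod_cast (Real.exp_pos _).ne'
    simp only [Function.comp_apply, Complex.real_smul]
    push_cast
    field_simp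
  · exact (Real.continuous_exp.comp (continuous_const.mul continuous_id)).continuousOn
  · intro z _
    have h1 : HasDerivAt (fun x : ℝ => Λ * x) (Λ * 1) z := (hasDerivAt_id' z).const_mul Λ
    exact h1.exp.congr_deriv (by ring)
  · intro z _
    positivity

/-! ### Continuity / integrability helpers on `(0, ∞)` -/

/-- A function continuous on `(0,∞)` is interval-integrable between positive endpoints. [folklore] -/
theorem intervalIntegrable_of_continuousOn_Ioi {Φ : ℝ → ℂ} (hΦ : ContinuousOn Φ (Ioi 0))
    {a b : ℝ} (ha : 0 < a) (hb : 0 < b) : IntervalIntegrable Φ volume a b :=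
  (hΦ.mono fun _ hx => (lt_min ha hb).trans_le hx.1).intervalIntegrable

/-- `x ↦ Φ(x)/x` is continuous on `(0,∞)` if `Φ` is. [folklore] -/
theorem continuousOn_div_ofReal {Φ : ℝ → ℂ} (hΦ : ContinuousOn Φ (Ioi 0)) :
    ContinuousOn (fun x : ℝ => Φ x / (x : ℂ)) (Ioi 0) :=
  hΦ.div Complex.continuous_ofReal.continuousOn fun _ hx => by exact_mod_cast (ne_of_gt hx)

/-- `x ↦ Φ(Q/x)` is continuous on `(0,∞)` if `Φ` is and `Q > 0`. [folklore] -/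
theorem continuousOn_comp_div {Φ : ℝ → ℂ} (hΦ : ContinuousOn Φ (Ioi 0)) {Q : ℝ} (hQ : 0 < Q) :
    ContinuousOn (fun x : ℝ => Φ (Q / x)) (Ioi 0) :=
  hΦ.comp (continuousOn_const.div continuousOn_id fun _ hx => ne_of_gt hx) fun _ hx => div_pos hQ hx

/-- `x ↦ Φ(cx)` is continuous on `(0,∞)` if `Φ` is and `c > 0`. [folklore] -/
theorem continuousOn_comp_mul {Φ : ℝ → ℂ} (hΦ : ContinuousOn Φ (Ioi 0)) {c : ℝ} (hc : 0 < c) :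
    ContinuousOn (fun x : ℝ => Φ (c * x)) (Ioi 0) :=
  hΦ.comp (continuousOn_const.mul continuousOn_id) fun _ hx => mul_pos hc hx

/-! ### (8.11) and (8.12) -/

/-- `P^θ` as a function of `Λ = log P`: `e^{Λθ}`. The manuscript's `P₁ = P^{0.504}` is `Ppow Λ 0.504`;
its `P₂ = P^{0.5}T^{-10}` ((2.21), `T = exp{ℒ^{1.1}}`) is `Ppow Λ θ₂` with `θ₂ = 0.5 − 10 log T/log P
= 0.5 − 10ℒ^{-7.9}`, main value `0.5`. [cite: Zhang2022LandauSiegel, (2.6), (2.21)] -/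
def Ppow (Λ θ : ℝ) : ℝ := rexp (Λ * θ)

/-- `P^θ > 0`. [folklore] -/
theorem Ppow_pos (Λ θ : ℝ) : 0 < Ppow Λ θ := Real.exp_pos _

/-- `log P^θ = θ log P`. [folklore] -/
theorem log_Ppow (Λ θ : ℝ) : Real.log (Ppow Λ θ) = Λ * θ := Real.log_exp _

/-- `P^{θ₁}/P^{θ₂} = P^{θ₁−θ₂}` ("since `P₁/P₂ = P^{0.004}T^{10}`"). [folklore] -/
theorem Ppow_div_Ppow (Λ θ₁ θ₂ : ℝ) : Ppow Λ θ₁ / Ppow Λ θ₂ = rexp (Λ * (θ₁ - θ₂)) := by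
  rw [Ppow, Ppow, ← Real.exp_sub]; congr 1; ring

/-- **(8.11)**, right-hand side, for one `j`, WITHOUT the factor `𝔞` and the `+o(α)`:
`∫₁^{P₂} (𝔣_{j6}(P₁/x)/log P₁ + ι₂𝔣_{j7}(P₂/x)/log P₂)(𝔤_{j6}(P₁/x)/log P₁ + ῑ₂𝔤_{j7}(P₂/x)/log P₂) dx/x
 + (log P₁)⁻² ∫_{P₂}^{P₁} 𝔣_{j6}(P₁/x)𝔤_{j6}(P₁/x) dx/x`,
as a functional of the four `x`-profiles `F6 = 𝔣_{j6}`, `F7 = 𝔣_{j7}`, `G6 = 𝔤_{j6}`, `G7 = 𝔤_{j7}`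
(`ℝ → ℂ`, used on `x > 0`) and of `P₁ = P^{θ₁}`, `P₂ = P^{θ₂}` (`Λ = log P`).
[cite: Zhang2022LandauSiegel, (8.11)] -/
def S811 (F6 F7 G6 G7 : ℝ → ℂ) (Λ θ₁ θ₂ : ℝ) : ℂ :=
  (∫ x in (1:ℝ)..Ppow Λ θ₂,
      (F6 (Ppow Λ θ₁ / x) / Real.log (Ppow Λ θ₁) + iota2 * F7 (Ppow Λ θ₂ / x) / Real.log (Ppow Λ θ₂))
        * (G6 (Ppow Λ θ₁ / x) / Real.log (Ppow Λ θ₁)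
            + conj iota2 * G7 (Ppow Λ θ₂ / x) / Real.log (Ppow Λ θ₂)) / x)
    + 1 / (Real.log (Ppow Λ θ₁) : ℂ) ^ 2
        * ∫ x in Ppow Λ θ₂..Ppow Λ θ₁, F6 (Ppow Λ θ₁ / x) * G6 (Ppow Λ θ₁ / x) / x

/-- **(8.12)**, right-hand side, for one `j`, WITHOUT `𝔞` and `+o(α)`:
`(log P₁)⁻² ∫₁^{P₁} 𝔣_{j6}𝔤_{j6} dx/x + |ι₂|²(log P₂)⁻² ∫₁^{P₂} 𝔣_{j7}𝔤_{j7} dx/x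
 + ι₂(log P₁ log P₂)⁻¹ ∫₁^{P₂} 𝔣_{j7}(x)𝔤_{j6}((P₁/P₂)x) dx/x
 + ῑ₂(log P₁ log P₂)⁻¹ ∫₁^{P₂} 𝔣_{j6}((P₁/P₂)x)𝔤_{j7}(x) dx/x`;
the manuscript writes the scaling factor `P₁/P₂` as `P^{0.004}T^{10}` (equal to it by (2.21)).
[cite: Zhang2022LandauSiegel, (8.12)] -/
def S812 (F6 F7 G6 G7 : ℝ → ℂ) (Λ θ₁ θ₂ : ℝ) : ℂ :=
  1 / (Real.log (Ppow Λ θ₁) : ℂ) ^ 2 * (∫ x in (1:ℝ)..Ppow Λ θ₁, F6 x * G6 x / x)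
    + (Complex.normSq iota2 : ℂ) / (Real.log (Ppow Λ θ₂) : ℂ) ^ 2
        * (∫ x in (1:ℝ)..Ppow Λ θ₂, F7 x * G7 x / x)
    + iota2 / (Real.log (Ppow Λ θ₁) * Real.log (Ppow Λ θ₂) : ℂ)
        * (∫ x in (1:ℝ)..Ppow Λ θ₂, F7 x * G6 (Ppow Λ θ₁ / Ppow Λ θ₂ * x) / x)
    + conj iota2 / (Real.log (Ppow Λ θ₁) * Real.log (Ppow Λ θ₂) : ℂ)
        * (∫ x in (1:ℝ)..Ppow Λ θ₂, F6 (Ppow Λ θ₁ / Ppow Λ θ₂ * x) * G7 x / x)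

/-- **(8.11) ⇒ (8.12)** ("This yields, by the change of variable `x → P₁/x` or `x → P₂/x`"):
PROVED for arbitrary profiles continuous on `(0,∞)` and arbitrary `Λ, θ₁, θ₂` — expand the product,
reflect the `𝔣_{j6}𝔤_{j6}` terms by `x ↦ P₁/x` (the two pieces `[1,P₂]`, `[P₂,P₁]` join to
`∫₁^{P₁}`) and the three others by `x ↦ P₂/x` (using `P₁/x = (P₁/P₂)(P₂/x)` in the cross terms).
[cite: Zhang2022LandauSiegel, (8.11)–(8.12)] -/
theorem S811_eq_S812 {F6 F7 G6 G7 : ℝ → ℂ} (hF6 : ContinuousOn F6 (Ioi 0))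
    (hF7 : ContinuousOn F7 (Ioi 0)) (hG6 : ContinuousOn G6 (Ioi 0)) (hG7 : ContinuousOn G7 (Ioi 0))
    (Λ θ₁ θ₂ : ℝ) : S811 F6 F7 G6 G7 Λ θ₁ θ₂ = S812 F6 F7 G6 G7 Λ θ₁ θ₂ := by
  have hp1 := Ppow_pos Λ θ₁
  have hp2 := Ppow_pos Λ θ₂
  have hc : 0 < Ppow Λ θ₁ / Ppow Λ θ₂ := div_pos hp1 hp2
  set p1 := Ppow Λ θ₁ with hp1def
  set p2 := Ppow Λ θ₂ with hp2def
  set L1 : ℂ := (Real.log p1 : ℂ)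
  set L2 : ℂ := (Real.log p2 : ℂ)
  set h66 : ℝ → ℂ := fun u => F6 u * G6 u
  set h77 : ℝ → ℂ := fun u => F7 u * G7 u
  set hX : ℝ → ℂ := fun u => F7 u * G6 (p1 / p2 * u)
  set hY : ℝ → ℂ := fun u => F6 (p1 / p2 * u) * G7 u
  have c66 : ContinuousOn h66 (Ioi 0) := hF6.mul hG6
  have c77 : ContinuousOn h77 (Ioi 0) := hF7.mul hG7
  have cX : ContinuousOn hX (Ioi 0) := hF7.mul (continuousOn_comp_mul hG6 hc)
  have cY : ContinuousOn hY (Ioi 0) := (continuousOn_comp_mul hF6 hc).mul hG7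
  -- pointwise expansion of the first integrand on `[1, P₂]`
  have expand : ∀ x ∈ uIcc (1:ℝ) p2,
      (F6 (p1 / x) / L1 + iota2 * F7 (p2 / x) / L2)
          * (G6 (p1 / x) / L1 + conj iota2 * G7 (p2 / x) / L2) / x
        = 1 / L1 ^ 2 * (h66 (p1 / x) / x) + (Complex.normSq iota2 : ℂ) / L2 ^ 2 * (h77 (p2 / x) / x)
          + iota2 / (L1 * L2) * (hX (p2 / x) / x) + conj iota2 / (L1 * L2) * (hY (p2 / x) / x) := by
    intro x hx
    have hx0 : x ≠ 0 := ((lt_min one_pos hp2).trans_le hx.1).ne'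
    have e1 : p1 / p2 * (p2 / x) = p1 / x := by field_simp
    simp only [h66, h77, hX, hY, e1, ← Complex.mul_conj]
    ring
  have I66 : IntervalIntegrable (fun x => h66 (p1 / x) / (x:ℂ)) volume 1 p2 :=
    intervalIntegrable_of_continuousOn_Ioi
      (continuousOn_div_ofReal (continuousOn_comp_div c66 hp1)) one_pos hp2
  have I77 : IntervalIntegrable (fun x => h77 (p2 / x) / (x:ℂ)) volume 1 p2 :=
    intervalIntegrable_of_continuousOn_Ioi
      (continuousOn_div_ofReal (continuousOn_comp_div c77 hp2)) one_pos hp2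
  have IX : IntervalIntegrable (fun x => hX (p2 / x) / (x:ℂ)) volume 1 p2 :=
    intervalIntegrable_of_continuousOn_Ioi
      (continuousOn_div_ofReal (continuousOn_comp_div cX hp2)) one_pos hp2
  have IY : IntervalIntegrable (fun x => hY (p2 / x) / (x:ℂ)) volume 1 p2 :=
    intervalIntegrable_of_continuousOn_Ioi
      (continuousOn_div_ofReal (continuousOn_comp_div cY hp2)) one_pos hp2
  -- split the first integral into four
  have split : (∫ x in (1:ℝ)..p2,
      (F6 (p1 / x) / L1 + iota2 * F7 (p2 / x) / L2)
        * (G6 (p1 / x) / L1 + conj iota2 * G7 (p2 / x) / L2) / x)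
      = 1 / L1 ^ 2 * (∫ x in (1:ℝ)..p2, h66 (p1 / x) / x)
        + (Complex.normSq iota2 : ℂ) / L2 ^ 2 * (∫ x in (1:ℝ)..p2, h77 (p2 / x) / x)
        + iota2 / (L1 * L2) * (∫ x in (1:ℝ)..p2, hX (p2 / x) / x)
        + conj iota2 / (L1 * L2) * (∫ x in (1:ℝ)..p2, hY (p2 / x) / x) := by
    rw [intervalIntegral.integral_congr expand,
      intervalIntegral.integral_add
        ((I66.const_mul _).add (I77.const_mul _) |>.add (IX.const_mul _)) (IY.const_mul _),
      intervalIntegral.integral_add ((I66.const_mul _).add (I77.const_mul _)) (IX.const_mul _),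
      intervalIntegral.integral_add (I66.const_mul _) (I77.const_mul _),
      intervalIntegral.integral_const_mul, intervalIntegral.integral_const_mul,
      intervalIntegral.integral_const_mul, intervalIntegral.integral_const_mul]
  -- the five reflections
  have R66a : (∫ x in (1:ℝ)..p2, h66 (p1 / x) / x) = ∫ u in p1/p2..p1, h66 u / u := by
    have := integral_comp_div_inv one_pos hp2 hp1 h66
    rwa [div_one] at this
  have R66b : (∫ x in p2..p1, h66 (p1 / x) / x) = ∫ u in (1:ℝ)..p1/p2, h66 u / u := by
    have := integral_comp_div_inv hp2 hp1 hp1 h66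
    rwa [div_self hp1.ne'] at this
  have R77 : (∫ x in (1:ℝ)..p2, h77 (p2 / x) / x) = ∫ u in (1:ℝ)..p2, h77 u / u := by
    have := integral_comp_div_inv one_pos hp2 hp2 h77
    rwa [div_self hp2.ne', div_one] at this
  have RX : (∫ x in (1:ℝ)..p2, hX (p2 / x) / x) = ∫ u in (1:ℝ)..p2, hX u / u := by
    have := integral_comp_div_inv one_pos hp2 hp2 hX
    rwa [div_self hp2.ne', div_one] at this
  have RY : (∫ x in (1:ℝ)..p2, hY (p2 / x) / x) = ∫ u in (1:ℝ)..p2, hY u / u := by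
    have := integral_comp_div_inv one_pos hp2 hp2 hY
    rwa [div_self hp2.ne', div_one] at this
  -- join `[1, P₁/P₂]` and `[P₁/P₂, P₁]`
  have adj : (∫ u in (1:ℝ)..p1/p2, h66 u / u) + (∫ u in p1/p2..p1, h66 u / u)
      = ∫ u in (1:ℝ)..p1, h66 u / u :=
    intervalIntegral.integral_add_adjacent_intervals
      (intervalIntegrable_of_continuousOn_Ioi (continuousOn_div_ofReal c66) one_pos hc)
      (intervalIntegrable_of_continuousOn_Ioi (continuousOn_div_ofReal c66) hc hp1)
  unfold S811 S812
  simp only [← hp1def, ← hp2def]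
  rw [split, R66a, R66b, R77, RX, RY, ← adj]
  simp only [h66, h77, hX, hY, L1, L2]
  ring

/-! ### "Substituting `x = Pᶻ`": the four displays after (8.18) and (8.12) in `z` -/

/-- `∫₁^{P^θ} Φ(x) dx/x = log P · ∫₀^θ Φ(Pᶻ) dz` (`log P = Λ ≥ 0`, any `Φ`). [folklore] -/
theorem integral_one_Ppow {Λ : ℝ} (hΛ : 0 ≤ Λ) (θ : ℝ) (Φ : ℝ → ℂ) :
    ∫ x in (1:ℝ)..Ppow Λ θ, Φ x / x = (Λ : ℂ) * ∫ z in (0:ℝ)..θ, Φ (rexp (Λ * z)) := by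
  have := integral_comp_exp_mul hΛ Φ (a := 0) (b := θ)
  rw [mul_zero, Real.exp_zero] at this
  rw [Ppow, this]

/-- First/second display after (8.18) (diagonal terms), for general `θ ≠ 0`:
`(log P₁)⁻² ∫₁^{P₁} 𝔣(x)𝔤(x) dx/x = (θ² log P)⁻¹ ∫₀^θ 𝔣𝔣(z)𝔤𝔥(z) dz` when `P₁ = P^θ` and
`𝔣(Pᶻ) = 𝔣𝔣(z)`, `𝔤(Pᶻ) = 𝔤𝔥(z)` (the manuscript: `θ = 0.504`, resp. `0.5`, "+o(α)").
[cite: Zhang2022LandauSiegel, §8, displays after (8.18)] -/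
theorem display818_diag {Λ θ : ℝ} (hΛ : 0 < Λ) (hθ : θ ≠ 0) {F G f g : ℝ → ℂ}
    (e : ∀ z, F (rexp (Λ * z)) = f z) (d : ∀ z, G (rexp (Λ * z)) = g z) :
    1 / (Real.log (Ppow Λ θ) : ℂ) ^ 2 * (∫ x in (1:ℝ)..Ppow Λ θ, F x * G x / x)
      = ((1 / (θ ^ 2 * Λ) : ℝ) : ℂ) * ∫ z in (0:ℝ)..θ, f z * g z := by
  have hΛ0 : (Λ : ℂ) ≠ 0 := by exact_mod_cast hΛ.ne'
  have hθ0 : (θ : ℂ) ≠ 0 := by exact_mod_cast hθ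
  rw [integral_one_Ppow hΛ.le θ (fun x => F x * G x), log_Ppow,
    intervalIntegral.integral_congr (g := fun z => f z * g z) fun z _ => by simp only [e, d]]
  push_cast
  field_simp

/-- Third display after (8.18) (cross term `ι₂`), general `θ₁, θ₂ ≠ 0`:
`(log P₁ log P₂)⁻¹ ∫₁^{P₂} 𝔣_{j7}(x)𝔤_{j6}((P₁/P₂)x) dx/x = (θ₁θ₂ log P)⁻¹ ∫₀^{θ₂} 𝔣𝔣_{j7}(z)𝔤𝔥_{j6}(z + θ₁ − θ₂) dz`
(the manuscript: `θ₁ − θ₂ = 0.004`, "+o(α)"). [cite: Zhang2022LandauSiegel, §8, displays after (8.18)] -/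
theorem display818_cross₁ {Λ θ₁ θ₂ : ℝ} (hΛ : 0 < Λ) (h₁ : θ₁ ≠ 0) (h₂ : θ₂ ≠ 0)
    {F7 G6 f7 g6 : ℝ → ℂ} (e : ∀ z, F7 (rexp (Λ * z)) = f7 z) (d : ∀ z, G6 (rexp (Λ * z)) = g6 z) :
    1 / (Real.log (Ppow Λ θ₁) * Real.log (Ppow Λ θ₂) : ℂ)
        * (∫ x in (1:ℝ)..Ppow Λ θ₂, F7 x * G6 (Ppow Λ θ₁ / Ppow Λ θ₂ * x) / x)
      = ((1 / (θ₁ * θ₂ * Λ) : ℝ) : ℂ) * ∫ z in (0:ℝ)..θ₂, f7 z * g6 (z + (θ₁ - θ₂)) := by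
  have hΛ0 : (Λ : ℂ) ≠ 0 := by exact_mod_cast hΛ.ne'
  have hθ1 : (θ₁ : ℂ) ≠ 0 := by exact_mod_cast h₁
  have hθ2 : (θ₂ : ℂ) ≠ 0 := by exact_mod_cast h₂
  have shift : ∀ z : ℝ, rexp (Λ * (θ₁ - θ₂)) * rexp (Λ * z) = rexp (Λ * (z + (θ₁ - θ₂))) := by
    intro z; rw [← Real.exp_add]; congr 1; ring
  rw [Ppow_div_Ppow, integral_one_Ppow hΛ.le θ₂ (fun x => F7 x * G6 (rexp (Λ * (θ₁ - θ₂)) * x)),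
    log_Ppow, log_Ppow,
    intervalIntegral.integral_congr (g := fun z => f7 z * g6 (z + (θ₁ - θ₂)))
      fun z _ => by simp only [shift, e, d]]
  push_cast
  field_simp

/-- Fourth display after (8.18) (cross term `ῑ₂`), general `θ₁, θ₂ ≠ 0`:
`(log P₁ log P₂)⁻¹ ∫₁^{P₂} 𝔣_{j6}((P₁/P₂)x)𝔤_{j7}(x) dx/x = (θ₁θ₂ log P)⁻¹ ∫₀^{θ₂} 𝔣𝔣_{j6}(z + θ₁ − θ₂)𝔤𝔥_{j7}(z) dz`.
[cite: Zhang2022LandauSiegel, §8, displays after (8.18)] -/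
theorem display818_cross₂ {Λ θ₁ θ₂ : ℝ} (hΛ : 0 < Λ) (h₁ : θ₁ ≠ 0) (h₂ : θ₂ ≠ 0)
    {F6 G7 f6 g7 : ℝ → ℂ} (e : ∀ z, F6 (rexp (Λ * z)) = f6 z) (d : ∀ z, G7 (rexp (Λ * z)) = g7 z) :
    1 / (Real.log (Ppow Λ θ₁) * Real.log (Ppow Λ θ₂) : ℂ)
        * (∫ x in (1:ℝ)..Ppow Λ θ₂, F6 (Ppow Λ θ₁ / Ppow Λ θ₂ * x) * G7 x / x)
      = ((1 / (θ₁ * θ₂ * Λ) : ℝ) : ℂ) * ∫ z in (0:ℝ)..θ₂, f6 (z + (θ₁ - θ₂)) * g7 z := by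
  have hΛ0 : (Λ : ℂ) ≠ 0 := by exact_mod_cast hΛ.ne'
  have hθ1 : (θ₁ : ℂ) ≠ 0 := by exact_mod_cast h₁
  have hθ2 : (θ₂ : ℂ) ≠ 0 := by exact_mod_cast h₂
  have shift : ∀ z : ℝ, rexp (Λ * (θ₁ - θ₂)) * rexp (Λ * z) = rexp (Λ * (z + (θ₁ - θ₂))) := by
    intro z; rw [← Real.exp_add]; congr 1; ring
  rw [Ppow_div_Ppow, integral_one_Ppow hΛ.le θ₂ (fun x => F6 (rexp (Λ * (θ₁ - θ₂)) * x) * G7 x),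
    log_Ppow, log_Ppow,
    intervalIntegral.integral_congr (g := fun z => f6 (z + (θ₁ - θ₂)) * g7 z)
      fun z _ => by simp only [shift, e, d]]
  push_cast
  field_simp

/-- **(8.12) in the variable `z`** (all four substitutions at once), general `θ₁, θ₂ ≠ 0`:
`S812 = (θ₁²Λ)⁻¹∫₀^{θ₁}𝔣𝔣_{j6}𝔤𝔥_{j6} + |ι₂|²(θ₂²Λ)⁻¹∫₀^{θ₂}𝔣𝔣_{j7}𝔤𝔥_{j7}
  + (θ₁θ₂Λ)⁻¹(ι₂∫₀^{θ₂}𝔣𝔣_{j7}(z)𝔤𝔥_{j6}(z+θ₁−θ₂) + ῑ₂∫₀^{θ₂}𝔣𝔣_{j6}(z+θ₁−θ₂)𝔤𝔥_{j7}(z))`.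
[cite: Zhang2022LandauSiegel, (8.12), displays after (8.18)] -/
theorem S812_eq_zform {Λ θ₁ θ₂ : ℝ} (hΛ : 0 < Λ) (h₁ : θ₁ ≠ 0) (h₂ : θ₂ ≠ 0)
    {F6 F7 G6 G7 f6 f7 g6 g7 : ℝ → ℂ}
    (e6 : ∀ z, F6 (rexp (Λ * z)) = f6 z) (e7 : ∀ z, F7 (rexp (Λ * z)) = f7 z)
    (d6 : ∀ z, G6 (rexp (Λ * z)) = g6 z) (d7 : ∀ z, G7 (rexp (Λ * z)) = g7 z) :
    S812 F6 F7 G6 G7 Λ θ₁ θ₂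
      = ((1 / (θ₁ ^ 2 * Λ) : ℝ) : ℂ) * (∫ z in (0:ℝ)..θ₁, f6 z * g6 z)
        + (Complex.normSq iota2 : ℂ) * ((1 / (θ₂ ^ 2 * Λ) : ℝ) : ℂ) * (∫ z in (0:ℝ)..θ₂, f7 z * g7 z)
        + ((1 / (θ₁ * θ₂ * Λ) : ℝ) : ℂ)
          * (iota2 * (∫ z in (0:ℝ)..θ₂, f7 z * g6 (z + (θ₁ - θ₂)))
              + conj iota2 * (∫ z in (0:ℝ)..θ₂, f6 (z + (θ₁ - θ₂)) * g7 z)) := by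
  have A := display818_diag hΛ h₁ (F := F6) (G := G6) e6 d6
  have B := display818_diag hΛ h₂ (F := F7) (G := G7) e7 d7
  have C := display818_cross₁ hΛ h₁ h₂ (F7 := F7) (G6 := G6) e7 d6
  have D := display818_cross₂ hΛ h₁ h₂ (F6 := F6) (G7 := G7) e6 d7
  unfold S812
  rw [A]
  have eB : (Complex.normSq iota2 : ℂ) / (Real.log (Ppow Λ θ₂) : ℂ) ^ 2
        * (∫ x in (1:ℝ)..Ppow Λ θ₂, F7 x * G7 x / x)
      = (Complex.normSq iota2 : ℂ) * (1 / (Real.log (Ppow Λ θ₂) : ℂ) ^ 2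
        * (∫ x in (1:ℝ)..Ppow Λ θ₂, F7 x * G7 x / x)) := by ring
  have eC : iota2 / (Real.log (Ppow Λ θ₁) * Real.log (Ppow Λ θ₂) : ℂ)
        * (∫ x in (1:ℝ)..Ppow Λ θ₂, F7 x * G6 (Ppow Λ θ₁ / Ppow Λ θ₂ * x) / x)
      = iota2 * (1 / (Real.log (Ppow Λ θ₁) * Real.log (Ppow Λ θ₂) : ℂ)
        * (∫ x in (1:ℝ)..Ppow Λ θ₂, F7 x * G6 (Ppow Λ θ₁ / Ppow Λ θ₂ * x) / x)) := by ring
  have eD : conj iota2 / (Real.log (Ppow Λ θ₁) * Real.log (Ppow Λ θ₂) : ℂ)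
        * (∫ x in (1:ℝ)..Ppow Λ θ₂, F6 (Ppow Λ θ₁ / Ppow Λ θ₂ * x) * G7 x / x)
      = conj iota2 * (1 / (Real.log (Ppow Λ θ₁) * Real.log (Ppow Λ θ₂) : ℂ)
        * (∫ x in (1:ℝ)..Ppow Λ θ₂, F6 (Ppow Λ θ₁ / Ppow Λ θ₂ * x) * G7 x / x)) := by ring
  rw [eB, B, eC, C, eD, D]
  ring

/-! ### The profiles of Lemmas 8.2/8.4 at the main values, as functions of real `x > 0` -/

/-- `𝔣_{jμ}(x) = (1 + (β_μ − β_j) log x) x^{β_μ}` (Lemma 8.2) at the main values `β_j⁰ = jiα`,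
`β_μ⁰ = μiα` (`μ = 3/2, 5/2` for `β₆, β₇`), as a function of real `x` (`x^β := e^{β log x}`).
[cite: Zhang2022LandauSiegel, Lemma 8.2] -/
def fX (j μ : ℚ) (α : ℝ) (x : ℝ) : ℂ := frakf (betaMain j α) (betaMain μ α) (Real.log x)

/-- `𝔤_{jμ}(x)` (Lemma 8.4) at the main values, `(β_{j+1}, β_{j+2}) = (β_{b1}⁰, β_{b2}⁰)` after the
reduction `β₄ = β₁, β₅ = β₂` (so `(b1,b2) = (2,3), (3,1), (1,2)` for `j = 1, 2, 3`), as a function of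
real `x`. [cite: Zhang2022LandauSiegel, Lemma 8.4] -/
def gX (b1 b2 μ : ℚ) (α : ℝ) (x : ℝ) : ℂ :=
  frakg (betaMain b1 α) (betaMain b2 α) (betaMain μ α) (Real.log x)

/-- `x ↦ log x ∈ ℂ` is continuous on `(0,∞)`. [folklore] -/
theorem continuousOn_ofReal_log : ContinuousOn (fun x : ℝ => (Real.log x : ℂ)) (Ioi 0) :=
  Complex.continuous_ofReal.comp_continuousOn (Real.continuousOn_log.mono fun _ hx => ne_of_gt hx)

/-- `𝔣_{jμ}` is continuous on `(0,∞)`. [folklore] -/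
theorem continuousOn_fX (j μ : ℚ) (α : ℝ) : ContinuousOn (fX j μ α) (Ioi 0) := by
  have hc : Continuous fun L : ℂ => frakf (betaMain j α) (betaMain μ α) L := by
    unfold frakf; fun_prop
  exact hc.comp_continuousOn continuousOn_ofReal_log

/-- `𝔤_{jμ}` is continuous on `(0,∞)`. [folklore] -/
theorem continuousOn_gX (b1 b2 μ : ℚ) (α : ℝ) : ContinuousOn (gX b1 b2 μ α) (Ioi 0) := by
  have hc : Continuous fun L : ℂ => frakg (betaMain b1 α) (betaMain b2 α) (betaMain μ α) L := by
    unfold frakg; fun_prop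
  exact hc.comp_continuousOn continuousOn_ofReal_log

/-- `𝔣_{jμ}(Pᶻ) = frakf β_j⁰ β_μ⁰ (z log P)` (the argument of `Section8MainTerms.frakf_main_*`). [folklore] -/
theorem fX_exp (j μ : ℚ) (α Λ z : ℝ) :
    fX j μ α (rexp (Λ * z)) = frakf (betaMain j α) (betaMain μ α) (z * Λ) := by
  unfold fX; rw [Real.log_exp]; push_cast; ring_nf

/-- `𝔤_{jμ}(Pᶻ) = frakg … (z log P)` (the argument of `Section8MainTerms.frakg_main_*`). [folklore] -/
theorem gX_exp (b1 b2 μ : ℚ) (α Λ z : ℝ) :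
    gX b1 b2 μ α (rexp (Λ * z)) = frakg (betaMain b1 α) (betaMain b2 α) (betaMain μ α) (z * Λ) := by
  unfold gX; rw [Real.log_exp]; push_cast; ring_nf

/-! ### The display before (8.19) -/

/-- `𝔣𝔣₁₆` is continuous. [folklore] -/ theorem continuous_ff16 : Continuous ff16 := continuous_ffF _ _
/-- `𝔣𝔣₂₆` is continuous. [folklore] -/ theorem continuous_ff26 : Continuous ff26 := continuous_ffF _ _
/-- `𝔣𝔣₃₆` is continuous. [folklore] -/ theorem continuous_ff36 : Continuous ff36 := continuous_ffF _ _
/-- `𝔣𝔣₁₇` is continuous. [folklore] -/ theorem continuous_ff17 : Continuous ff17 := continuous_ffF _ _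
/-- `𝔣𝔣₂₇` is continuous. [folklore] -/ theorem continuous_ff27 : Continuous ff27 := continuous_ffF _ _
/-- `𝔣𝔣₃₇` is continuous. [folklore] -/ theorem continuous_ff37 : Continuous ff37 := continuous_ffF _ _
/-- `𝔤𝔥₁₆` is continuous. [folklore] -/
theorem continuous_gh16 : Continuous gh16 := continuous_ghF _ _ _ _
/-- `𝔤𝔥₂₆` is continuous. [folklore] -/
theorem continuous_gh26 : Continuous gh26 := continuous_ghF _ _ _ _
/-- `𝔤𝔥₃₆` is continuous. [folklore] -/
theorem continuous_gh36 : Continuous gh36 := continuous_ghF _ _ _ _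
/-- `𝔤𝔥₁₇` is continuous. [folklore] -/
theorem continuous_gh17 : Continuous gh17 := continuous_ghF _ _ _ _
/-- `𝔤𝔥₂₇` is continuous. [folklore] -/
theorem continuous_gh27 : Continuous gh27 := continuous_ghF _ _ _ _
/-- `𝔤𝔥₃₇` is continuous. [folklore] -/
theorem continuous_gh37 : Continuous gh37 := continuous_ghF _ _ _ _

attribute [local fun_prop] continuous_ff16 continuous_ff26 continuous_ff36 continuous_ff17
  continuous_ff27 continuous_ff37 continuous_gh16 continuous_gh26 continuous_gh36 continuous_gh17
  continuous_gh27 continuous_gh37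

/-- (8.19) with the three `j`-terms as separate integrals. [cite: Zhang2022LandauSiegel, (8.19)] -/
theorem b11_split : b11 = ((1 / (0.504 ^ 2 * π) : ℝ) : ℂ) *
    (1/2 * (∫ z in (0:ℝ)..0.504, ff16 z * gh16 z) + 2 * (∫ z in (0:ℝ)..0.504, ff26 z * gh26 z)
      + 3/2 * (∫ z in (0:ℝ)..0.504, ff36 z * gh36 z)) := by
  unfold b11; rw [integral_wsum3] <;> fun_prop

/-- (8.20) with the three `j`-terms as separate integrals. [cite: Zhang2022LandauSiegel, (8.20)] -/
theorem b22_split : b22 = ((1 / (0.5 ^ 2 * π) : ℝ) : ℂ) *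
    (1/2 * (∫ z in (0:ℝ)..0.5, ff17 z * gh17 z) + 2 * (∫ z in (0:ℝ)..0.5, ff27 z * gh27 z)
      + 3/2 * (∫ z in (0:ℝ)..0.5, ff37 z * gh37 z)) := by
  unfold b22; rw [integral_wsum3] <;> fun_prop

/-- (8.21) with the three `j`-terms as separate integrals. [cite: Zhang2022LandauSiegel, (8.21)] -/
theorem b21_split : b21 = ((1 / (0.504 * 0.5 * π) : ℝ) : ℂ) *
    (1/2 * (∫ z in (0:ℝ)..0.5, ff17 z * gh16 (z + 0.004))
      + 2 * (∫ z in (0:ℝ)..0.5, ff27 z * gh26 (z + 0.004))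
      + 3/2 * (∫ z in (0:ℝ)..0.5, ff37 z * gh36 (z + 0.004))) := by
  unfold b21; rw [integral_wsum3] <;> fun_prop

/-- (8.22) with the three `j`-terms as separate integrals. [cite: Zhang2022LandauSiegel, (8.22)] -/
theorem b12_split : b12 = ((1 / (0.504 * 0.5 * π) : ℝ) : ℂ) *
    (1/2 * (∫ z in (0:ℝ)..0.5, ff16 (z + 0.004) * gh17 z)
      + 2 * (∫ z in (0:ℝ)..0.5, ff26 (z + 0.004) * gh27 z)
      + 3/2 * (∫ z in (0:ℝ)..0.5, ff36 (z + 0.004) * gh37 z)) := by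
  unfold b12; rw [integral_wsum3] <;> fun_prop

/-- `S₁(a₁₁,a₂₁)` of (8.11) at main order (shifts at main values; `j = 1`, `(β_{j+1},β_{j+2}) = (β₂,β₃)`;
`P₁ = P^{θ₁}`, `P₂ = P^{θ₂}`; no `𝔞`, no `o(α)`). [cite: Zhang2022LandauSiegel, (8.11)] -/
def S811main1 (α Λ θ₁ θ₂ : ℝ) : ℂ :=
  S811 (fX 1 (3/2) α) (fX 1 (5/2) α) (gX 2 3 (3/2) α) (gX 2 3 (5/2) α) Λ θ₁ θ₂

/-- `S₂(a₁₁,a₂₁)` of (8.11) at main order (`j = 2`, `(β₃, β₄) = (β₃, β₁)`).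
[cite: Zhang2022LandauSiegel, (8.11)] -/
def S811main2 (α Λ θ₁ θ₂ : ℝ) : ℂ :=
  S811 (fX 2 (3/2) α) (fX 2 (5/2) α) (gX 3 1 (3/2) α) (gX 3 1 (5/2) α) Λ θ₁ θ₂

/-- `S₃(a₁₁,a₂₁)` of (8.11) at main order (`j = 3`, `(β₄, β₅) = (β₁, β₂)`).
[cite: Zhang2022LandauSiegel, (8.11)] -/
def S811main3 (α Λ θ₁ θ₂ : ℝ) : ℂ :=
  S811 (fX 3 (3/2) α) (fX 3 (5/2) α) (gX 1 2 (3/2) α) (gX 1 2 (5/2) α) Λ θ₁ θ₂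

/-- **The display before (8.19)** ("Inserting these into (8.13) we obtain
`(2α)⁻¹S₁ + 2α⁻¹S₂ + (3/2)α⁻¹S₃ = 𝔞(b₁₁ + ι₂b₂₁ + ῑ₂b₁₂ + |ι₂|²b₂₂) + o(1)`"), PROVED EXACTLY at
main order: with `α log P = π` ((2.10)), `P₁ = P^{0.504}`, `P₂ = P^{0.5}` (main value of (2.21)) and
the shifts at their main values, the weighted sum of the (8.11) expressions (weights `1/2, 2, 3/2`
and `α⁻¹` from Proposition 7.1) equals `b₁₁ + ι₂b₂₁ + ῑ₂b₁₂ + |ι₂|²b₂₂` with the `b_{kl}` EXACTLY as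
printed in (8.19)–(8.22) (`Section8Defs.b11 … b12`). Chain: `S811_eq_S812`, `S812_eq_zform`,
`Section8MainTerms.frakf_main_*`/`frakg_main_*`, `0.504 − 0.5 = 0.004`, linear algebra.
[cite: Zhang2022LandauSiegel, §8, display before (8.19)] -/
theorem weighted_sum_S811_main {α Λ : ℝ} (hα : 0 < α) (hΛ : 0 < Λ) (h : α * Λ = π) :
    1 / (2 * (α : ℂ)) * S811main1 α Λ 0.504 0.5 + 2 / (α : ℂ) * S811main2 α Λ 0.504 0.5
        + 3 / (2 * (α : ℂ)) * S811main3 α Λ 0.504 0.5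
      = b11 + iota2 * b21 + conj iota2 * b12 + (Complex.normSq iota2 : ℂ) * b22 := by
  have hα0 : α ≠ 0 := hα.ne'
  have hαC : (α : ℂ) ≠ 0 := by exact_mod_cast hα0
  have hΛC : (Λ : ℂ) ≠ 0 := by exact_mod_cast hΛ.ne'
  have h₁ : (0.504 : ℝ) ≠ 0 := by norm_num
  have h₂ : (0.5 : ℝ) ≠ 0 := by norm_num
  have hδ : (0.504 : ℝ) - 0.5 = 0.004 := by norm_num
  have hπ : (π : ℂ) = (α : ℂ) * Λ := by rw [← Complex.ofReal_mul, h]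
  unfold S811main1 S811main2 S811main3
  rw [S811_eq_S812 (continuousOn_fX _ _ _) (continuousOn_fX _ _ _) (continuousOn_gX _ _ _ _)
      (continuousOn_gX _ _ _ _),
    S811_eq_S812 (continuousOn_fX _ _ _) (continuousOn_fX _ _ _) (continuousOn_gX _ _ _ _)
      (continuousOn_gX _ _ _ _),
    S811_eq_S812 (continuousOn_fX _ _ _) (continuousOn_fX _ _ _) (continuousOn_gX _ _ _ _)
      (continuousOn_gX _ _ _ _)]
  rw [S812_eq_zform hΛ h₁ h₂ (f6 := ff16) (f7 := ff17) (g6 := gh16) (g7 := gh17)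
      (fun z => by rw [fX_exp, frakf_main_16 h]) (fun z => by rw [fX_exp, frakf_main_17 h])
      (fun z => by rw [gX_exp, frakg_main_16 hα0 h]) (fun z => by rw [gX_exp, frakg_main_17 hα0 h]),
    S812_eq_zform hΛ h₁ h₂ (f6 := ff26) (f7 := ff27) (g6 := gh26) (g7 := gh27)
      (fun z => by rw [fX_exp, frakf_main_26 h]) (fun z => by rw [fX_exp, frakf_main_27 h])
      (fun z => by rw [gX_exp, frakg_main_26 hα0 h]) (fun z => by rw [gX_exp, frakg_main_27 hα0 h]),
    S812_eq_zform hΛ h₁ h₂ (f6 := ff36) (f7 := ff37) (g6 := gh36) (g7 := gh37)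
      (fun z => by rw [fX_exp, frakf_main_36 h]) (fun z => by rw [fX_exp, frakf_main_37 h])
      (fun z => by rw [gX_exp, frakg_main_36 hα0 h]) (fun z => by rw [gX_exp, frakg_main_37 hα0 h]),
    hδ, b11_split, b22_split, b21_split, b12_split]
  push_cast
  rw [hπ]
  field_simp
  ring

/-! ### (8.7) and (8.23) -/

/-- The main-term coefficient of `Θ₁(a₁₁,a₂₁)/(𝔞𝔓)` (display after (8.22)):
`B := b₁₁ + ι₂b₂₁ + ῑ₂b₁₂ + |ι₂|²b₂₂`. [cite: Zhang2022LandauSiegel, §8, display after (8.22)] -/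
def Theta1Coeff : ℂ := b11 + iota2 * b21 + conj iota2 * b12 + (Complex.normSq iota2 : ℂ) * b22

/-- (8.7) `Ξ₁₁ = 2Re Θ₁(a₁₁,a₂₁) + o(𝔓)` (Lemma 8.1 with `a₂₁ = ā₁₁`) and (8.23): the printed
`𝔠₁ = c₁₁ + ι₂c₂₁ + ῑ₂c₁₂ + |ι₂|²c₂₂` with `c₁₁ = b₁₁ + b̄₁₁`, `c₂₂ = b₂₂ + b̄₂₂`, `c₁₂ = b₁₂ + b̄₂₁`,
`c₂₁ = c̄₁₂` (`Section8Defs`) IS `B + B̄` — pure algebra. [cite: Zhang2022LandauSiegel, (8.7), (8.23)] -/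
theorem frakc1_eq_coeff_add_conj : frakc1 = Theta1Coeff + conj Theta1Coeff := by
  unfold frakc1 Theta1Coeff c21
  unfold c11 c22 c12
  simp only [map_add, map_mul, Complex.conj_conj, Complex.conj_ofReal]
  ring

/-- **End to end at main order.** Let `W := (2α)⁻¹S₁ + 2α⁻¹S₂ + (3/2)α⁻¹S₃` be the weighted sum of
the (8.11) expressions (`α log P = π`, `P₁ = P^{0.504}`, `P₂ = P^{0.5}`, shifts at main values). Then
`W + W̄ = 𝔠₁` (the printed (8.23)), hence `Re(W + W̄) > 7.0501` (`Section8Certificate.frakc1_re_bounds`)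
and the printed (8.24) `𝔠₁ < 6.9955` fails already for the (8.11)-level quantity
(`Section8Certificate.not_ineq824`): the discrepancy is not introduced anywhere between (8.11) and
(8.23). [cite: Zhang2022LandauSiegel, (8.11), (8.23), (8.24)] -/
theorem weighted_sum_S811_add_conj {α Λ : ℝ} (hα : 0 < α) (hΛ : 0 < Λ) (h : α * Λ = π) :
    let W := 1 / (2 * (α : ℂ)) * S811main1 α Λ 0.504 0.5 + 2 / (α : ℂ) * S811main2 α Λ 0.504 0.5
      + 3 / (2 * (α : ℂ)) * S811main3 α Λ 0.504 0.5
    W + conj W = frakc1 ∧ (7.0501 : ℝ) < (W + conj W).re ∧ ¬ ((W + conj W).re < 6.9955) := by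
  intro W
  have hW : W = Theta1Coeff := weighted_sum_S811_main hα hΛ h
  have e : W + conj W = frakc1 := by rw [hW, frakc1_eq_coeff_add_conj]
  refine ⟨e, ?_, ?_⟩
  · rw [e]; exact frakc1_re_bounds.1
  · rw [e]; exact not_ineq824

end Literature.NumberTheory.LFunctions.Zhang2022
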